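import Summits.Ventures.YMGap.Thresholds.CouplingDerivative
import HarnessLib

/-!
# Venture YMGap — tools for C-SUS3 / C-DIFF2: explicit-constant clustering of the `SU(2)`, `d = 4` strong-coupling
# state, the connected three-point function (cumulant algebra), and the geometry of the three splits

HONEST FRAMING: venture file of the cell `pub-ymgap` (QuantumFields programme), seat ds-1 (gen 10).  Strong-coupling
LATTICE statements for `SU(2)` lattice Yang–Mills on `ℤ^4` with the Wilson action inside the one-sided vertex-star
window `0 ≤ β_W ≤ 9/25` (tree bare coupling `β_W/2`); covariance estimates of the unique DLR state and elementary
bookkeeping only; nothing about the continuum, confinement at weak coupling, or the Clay problem.  Consumed by the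
sibling files `ConnectedThreePointDecay` (tree decay of `u₃`) and `CouplingSecondDerivative` (the state is `C²`).

* `su2Star_limitState_cov_le_of_sep` / ★ `su2_abs_cov_le_of_sep` — EXPLICIT-CONSTANT clustering: for `β₁ ≤ 9/25`,
  `κ = starRate (R_G β₁)`, the DLR state `μ` at ANY `0 ≤ β_W ≤ β₁` and Lipschitz cylinders `F₁, F₂` whose base
  points are pairwise `≥ m` apart, `|Cov_μ(F₁, F₂)| ≤ 4(2√2)² e^{−κ(m−2)} (#Λ₁K₁)(#Λ₂K₂)` (ds-2's
  `su2Star_limitState_clustering` hides the constant behind `∃ c₁`; uniform in `β_W ≤ β₁`);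
* `threePoint_eq_moments`, `threePoint_swap`, `threePoint_rotate`, `abs_threePoint_le` — the connected three-point
  function `u₃(X; Y; Z) = Cov(XY, Z) − E[X] Cov(Y, Z) − E[Y] Cov(X, Z)` is the symmetric third cumulant, and one
  split bounds it by three covariances;
* `quarter_le_max_three_splits`, `tree_bound_of_three_splits`, `sep_of_near`, `bracket_plaquette_le`,
  `bracket_cylinder_le` — the best of the three splits decays like a quarter of the tree length; bookkeeping.

References (mechanism only): R. L. Dobrushin, S. B. Shlosman (1985/87); B. Simon, *The Statistical Mechanics of
Lattice Gases* I (1993), §II.12 (Ursell functions).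
-/

noncomputable section

open MeasureTheory ProbabilityTheory Function Finset Filter Topology Real Set
open scoped NNReal
open Literature.Probability.LatticeModels (Torus.proj Torus.proj_apply)
open Literature.MathematicalPhysics.QuantumLattice (LGConfig ZdEdge ZdPlaquette plaquetteEdges torusLift torusEdge
  toTorusObservable fundamentalRep fundamentalRep_mem_unitaryGroup continuous_fundamentalRep ymSpecification
  ymGibbsMeasures infiniteVolumeLimitPoints
  IsInfiniteVolumeLimitAlong infiniteVolumeLimitPoints_nonempty_holds
  mem_ymGibbsMeasures_of_mem_infiniteVolumeLimitPoints_holds)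
open Literature.MathematicalPhysics.QuantumFieldTheory hiding ZdEdge
open Summit.Ventures.YMGap.DSWindow (StarWindowBound starRate starRate_pos)
open Summit.Ventures.YMGap.StarWindowGauge (gaugeR gaugeR_lt_one_of_le)
open Summit.Ventures.YMGap.StarLemmaG (gaugeR_nonneg)
open Summit.Ventures.YMGap.StarLimit (continuous_of_isLipschitzCylinder su2Star_torus_cov_lipschitz
  abs_cov_le_of_eventually_torus linkObs_toTorusObservable)
open Summit.Ventures.YMGap.RobustBall (l1 l1_sub_comm numOrient)
open Summit.Ventures.YMGap.LinearResponseBound (summable_and_tsum_base_le)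

namespace Summit.Ventures.YMGap.CouplingResponse

/-! ### §1 Explicit-constant clustering for limit states and for the DLR state on the window -/

section Clustering

/-- **Explicit-constant clustering for infinite-volume limit states** (`SU(2)`, `d = 4`, Wilson coupling `β_W`):
if every torus of side `L ≥ L₁` carries `StarWindowBound L β_W ρ suFrobDist` (`0 ≤ ρ < 1`), then for every limit
state `μ ∈ infiniteVolumeLimitPoints (d := 4) (fundamentalRep (Fin 2)) (β_W/2)`, all Lipschitz cylinders `F₁, F₂`
(supports `Λ₁, Λ₂`, constants `K₁, K₂`) whose base points are pairwise `≥ m` apart in the sup-norm: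
`|Cov_μ(F₁, F₂)| ≤ 4(2√2)² e^{−κ(ρ)(m−2)} (#Λ₁K₁)(#Λ₂K₂)` — ds-2's torus door `su2Star_torus_cov_lipschitz` on
the tori of the defining subsequence (isometric projection below half the period) passed to the weak limit
(`abs_cov_le_of_eventually_torus`).  Same proof as `StarLimit.su2Star_limitState_clustering`, constant kept. -/
theorem su2Star_limitState_cov_le_of_sep (βW : ℝ) {ρ : ℝ} (hρ0 : 0 ≤ ρ) (hρ1 : ρ < 1) (L₁ : ℕ)
    (hS : ∀ (L : ℕ) [NeZero L], L₁ ≤ L → StarWindowBound L βW ρ suFrobDist)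
    {μ : Measure (LGConfig 4 (Matrix.specialUnitaryGroup (Fin 2) ℂ))}
    (hμ : μ ∈ infiniteVolumeLimitPoints (d := 4) (fundamentalRep (Fin 2)) (βW / 2))
    {F₁ F₂ : LGConfig 4 (Matrix.specialUnitaryGroup (Fin 2) ℂ) → ℝ} {Λ₁ Λ₂ : Finset (ZdEdge 4)} {K₁ K₂ : ℝ≥0}
    (hF₁ : IsLipschitzCylinder (fundamentalRep (Fin 2)) F₁ Λ₁ K₁)
    (hF₂ : IsLipschitzCylinder (fundamentalRep (Fin 2)) F₂ Λ₂ K₂) {m : ℕ}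
    (hgeom : ∀ a ∈ Λ₁, ∀ b ∈ Λ₂, (m : ℝ) ≤ ‖a.1 - b.1‖) :
    |cov[F₁, F₂; μ]| ≤ 4 * (2 * Real.sqrt 2) ^ 2 * Real.exp (-(starRate ρ * ((m - 2 : ℕ) : ℝ))) *
      ((Λ₁.card : ℝ) * K₁) * ((Λ₂.card : ℝ) * K₂) := by
  classical
  haveI : SecondCountableTopology (Matrix (Fin 2) (Fin 2) ℂ) :=
    inferInstanceAs (SecondCountableTopology (Fin 2 → Fin 2 → ℂ))
  haveI : SecondCountableTopology (Matrix.specialUnitaryGroup (Fin 2) ℂ) :=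
    Topology.IsEmbedding.subtypeVal.secondCountableTopology
  obtain ⟨Lseq, hLmono, hμL⟩ := hμ
  haveI := hμL.1
  set Dmax : ℕ := ((Λ₁ ∪ Λ₂) ×ˢ (Λ₁ ∪ Λ₂)).sup fun ab =>
    Literature.Probability.LatticeModels.Site.supNorm (ab.1.1 - ab.2.1) with hDmax
  have hDm : ∀ a ∈ Λ₁ ∪ Λ₂, ∀ b ∈ Λ₁ ∪ Λ₂,
      Literature.Probability.LatticeModels.Site.supNorm (a.1 - b.1) ≤ Dmax := fun a ha b hb =>
    Finset.le_sup (f := fun ab : ZdEdge 4 × ZdEdge 4 =>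
      Literature.Probability.LatticeModels.Site.supNorm (ab.1.1 - ab.2.1)) (Finset.mk_mem_product ha hb)
  refine abs_cov_le_of_eventually_torus (fundamentalRep (Fin 2)) hμL
    (continuous_of_isLipschitzCylinder hF₁) (continuous_of_isLipschitzCylinder hF₂) hF₁.measurable
    hF₂.measurable hF₁.isCylinder hF₂.isCylinder (fun U => hF₁.abs_le U) (fun U => hF₂.abs_le U) ?_
  filter_upwards [eventually_ge_atTop (max L₁ (2 * Dmax))] with k hk
  have hkL : max L₁ (2 * Dmax) ≤ Lseq k := hk.trans hLmono.le_apply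
  have hSW := hS (Lseq k + 1) (by omega)
  -- below half the period the projection is isometric on `Λ₁ ∪ Λ₂`
  have hiso : ∀ a ∈ Λ₁ ∪ Λ₂, ∀ b ∈ Λ₁ ∪ Λ₂,
      torusNorm ((torusEdge (Lseq k + 1) a).1 - (torusEdge (Lseq k + 1) b).1) =
        Literature.Probability.LatticeModels.Site.supNorm (a.1 - b.1) := by
    intro a ha b hb
    have hlt : 2 * Literature.Probability.LatticeModels.Site.supNorm (a.1 - b.1) < Lseq k + 1 := by
      have := hDm a ha b hb; omega
    have e : (torusEdge (Lseq k + 1) a).1 - (torusEdge (Lseq k + 1) b).1 =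
        Torus.proj (Lseq k + 1) (a.1 - b.1) := by
      show Torus.proj (Lseq k + 1) a.1 - Torus.proj (Lseq k + 1) b.1 = _
      rw [sub_eq_add_neg, ← torusProj_neg_zd, ← torusProj_add_zd, ← sub_eq_add_neg]
    rw [e]
    exact torusNorm_proj_eq hlt
  have hinj : ∀ a ∈ Λ₁ ∪ Λ₂, ∀ b ∈ Λ₁ ∪ Λ₂,
      torusEdge (Lseq k + 1) a = torusEdge (Lseq k + 1) b → a = b := by
    intro a ha b hb hab
    have h1 : (torusEdge (Lseq k + 1) a).1 = (torusEdge (Lseq k + 1) b).1 := by rw [hab]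
    have h2 : a.2 = b.2 := by
      have := congrArg Prod.snd hab; exact this
    have h0 : Literature.Probability.LatticeModels.Site.supNorm (a.1 - b.1) = 0 := by
      rw [← hiso a ha b hb, h1, sub_self, torusNorm_zero]
    have h3 : a.1 = b.1 :=
      sub_eq_zero.1 (Literature.Probability.LatticeModels.Site.supNorm_eq_zero_iff.1 h0)
    exact Prod.ext h3 h2
  have hinj₁ : ∀ e ∈ Λ₁, ∀ e' ∈ Λ₁, torusEdge (Lseq k + 1) e = torusEdge (Lseq k + 1) e' → e = e' :=
    fun e he e' he' => hinj e (Finset.mem_union_left _ he) e' (Finset.mem_union_left _ he')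
  have hinj₂ : ∀ e ∈ Λ₂, ∀ e' ∈ Λ₂, torusEdge (Lseq k + 1) e = torusEdge (Lseq k + 1) e' → e = e' :=
    fun e he e' he' => hinj e (Finset.mem_union_right _ he) e' (Finset.mem_union_right _ he')
  have hgeom' : ∀ a ∈ Λ₁, ∀ b ∈ Λ₂,
      m ≤ torusNorm ((torusEdge (Lseq k + 1) a).1 - (torusEdge (Lseq k + 1) b).1) := by
    intro a ha b hb
    rw [hiso a (Finset.mem_union_left _ ha) b (Finset.mem_union_right _ hb)]
    have h := hgeom a ha b hb
    rw [Literature.Probability.LatticeModels.Site.norm_eq_supNorm] at h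
    exact_mod_cast h
  have h := su2Star_torus_cov_lipschitz βW hρ0 hρ1 hSW hF₁ hF₂ hinj₁ hinj₂ hgeom'
  have hcov : cov[toTorusObservable (Lseq k + 1) F₁, toTorusObservable (Lseq k + 1) F₂;
      wilsonMeasure (d := 4) (L := Lseq k + 1) (fundamentalRep (Fin 2)) (βW / 2)] =
      (∫ V, toTorusObservable (Lseq k + 1) F₁ V * toTorusObservable (Lseq k + 1) F₂ V
          ∂(wilsonMeasure (d := 4) (L := Lseq k + 1) (fundamentalRep (Fin 2)) (βW / 2))) -
        (∫ V, toTorusObservable (Lseq k + 1) F₁ V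
          ∂(wilsonMeasure (d := 4) (L := Lseq k + 1) (fundamentalRep (Fin 2)) (βW / 2))) *
          ∫ V, toTorusObservable (Lseq k + 1) F₂ V
            ∂(wilsonMeasure (d := 4) (L := Lseq k + 1) (fundamentalRep (Fin 2)) (βW / 2)) := by
    haveI : IsProbabilityMeasure
        (wilsonMeasure (d := 4) (L := Lseq k + 1) (fundamentalRep (Fin 2)) (βW / 2)) :=
      isProbabilityMeasure_wilsonMeasure (d := 4) (L := Lseq k + 1) _ (continuous_fundamentalRep (Fin 2)) _
    have hfo := linkObs_toTorusObservable (L := Lseq k + 1) hF₁ hinj₁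
    have hgo := linkObs_toTorusObservable (L := Lseq k + 1) hF₂ hinj₂
    obtain ⟨B₁, hB₁⟩ := hfo.bounded
    obtain ⟨B₂, hB₂⟩ := hgo.bounded
    have l₁ : MemLp (toTorusObservable (Lseq k + 1) F₁) 2
        (wilsonMeasure (d := 4) (L := Lseq k + 1) (fundamentalRep (Fin 2)) (βW / 2)) :=
      memLp_of_bounded (a := -B₁) (b := B₁) (ae_of_all _ fun U => abs_le.1 (hB₁ U))
        hfo.measurable.aestronglyMeasurable 2
    have l₂ : MemLp (toTorusObservable (Lseq k + 1) F₂) 2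
        (wilsonMeasure (d := 4) (L := Lseq k + 1) (fundamentalRep (Fin 2)) (βW / 2)) :=
      memLp_of_bounded (a := -B₂) (b := B₂) (ae_of_all _ fun U => abs_le.1 (hB₂ U))
        hgo.measurable.aestronglyMeasurable 2
    exact covariance_eq_sub l₁ l₂
  rw [← hcov]
  exact h

/-- **Explicit-constant clustering for THE DLR state on the window** (`SU(2)`, `d = 4`, hypothesis-free): for
`β₁ ≤ 9/25`, every `0 ≤ β_W ≤ β₁`, the DLR state `μ` at tree coupling `2·(β_W/4)` (unique by
`su2_hasUniqueGibbsMeasure_le_9_25`, hence an infinite-volume limit point), all Lipschitz cylinders `F₁, F₂` whose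
base points are pairwise `≥ m` apart: `|Cov_μ(F₁, F₂)| ≤ 4(2√2)² e^{−κ(m−2)} (#Λ₁K₁)(#Λ₂K₂)` with ONE rate
`κ = starRate (R_G β₁)` for the whole window (Lemma G + monotonicity, `su2_starWindowBound_uniform`). -/
theorem su2_abs_cov_le_of_sep {β₁ : ℝ} (h1 : β₁ ≤ 9 / 25) {βW : ℝ} (h0 : 0 ≤ βW) (hβ : βW ≤ β₁)
    {μ : Measure (LGConfig 4 (Matrix.specialUnitaryGroup (Fin 2) ℂ))}
    (hμ : μ ∈ ymGibbsMeasures (d := 4) (fundamentalRep (Fin 2)) (2 * (βW / 4)))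
    {F₁ F₂ : LGConfig 4 (Matrix.specialUnitaryGroup (Fin 2) ℂ) → ℝ} {Λ₁ Λ₂ : Finset (ZdEdge 4)} {K₁ K₂ : ℝ≥0}
    (hF₁ : IsLipschitzCylinder (fundamentalRep (Fin 2)) F₁ Λ₁ K₁)
    (hF₂ : IsLipschitzCylinder (fundamentalRep (Fin 2)) F₂ Λ₂ K₂) {m : ℕ}
    (hgeom : ∀ a ∈ Λ₁, ∀ b ∈ Λ₂, (m : ℝ) ≤ ‖a.1 - b.1‖) :
    |cov[F₁, F₂; μ]| ≤ 4 * (2 * Real.sqrt 2) ^ 2 * Real.exp (-(starRate (gaugeR β₁) * ((m - 2 : ℕ) : ℝ))) *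
      ((Λ₁.card : ℝ) * K₁) * ((Λ₂.card : ℝ) * K₂) := by
  haveI : SecondCountableTopology (Matrix (Fin 2) (Fin 2) ℂ) :=
    inferInstanceAs (SecondCountableTopology (Fin 2 → Fin 2 → ℂ))
  haveI : SecondCountableTopology (Matrix.specialUnitaryGroup (Fin 2) ℂ) :=
    Topology.IsEmbedding.subtypeVal.secondCountableTopology
  have hβ₁0 : 0 ≤ β₁ := h0.trans hβ
  have hρ0 : 0 ≤ gaugeR β₁ := gaugeR_nonneg hβ₁0 (by linarith)
  have hρ1 : gaugeR β₁ < 1 := gaugeR_lt_one_of_le hβ₁0 h1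
  have hρc := continuous_fundamentalRep (Fin 2)
  -- the DLR state is unique, hence it is an infinite-volume limit point
  have hu := DSWindowZd.su2_hasUniqueGibbsMeasure_le_9_25 h0 (hβ.trans h1)
  have e : ((2 : ℕ) : ℝ) * (βW / 4) = βW / 2 := by push_cast; ring
  have e' : (2 : ℝ) * (βW / 4) = βW / 2 := by ring
  rw [e] at hu
  rw [e'] at hμ
  obtain ⟨ν, hν⟩ := infiniteVolumeLimitPoints_nonempty_holds (d := 4) (fundamentalRep (Fin 2)) hρc (βW / 2)
  have hνG : ν ∈ ymGibbsMeasures (d := 4) (fundamentalRep (Fin 2)) (βW / 2) :=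
    mem_ymGibbsMeasures_of_mem_infiniteVolumeLimitPoints_holds (d := 4) (fundamentalRep (Fin 2)) hρc hν
  have hμν : μ = ν := hu.1 hμ hνG
  subst hμν
  exact su2Star_limitState_cov_le_of_sep βW hρ0 hρ1 3
    (fun L _ hL => su2_starWindowBound_uniform hL h0 hβ h1) hν hF₁ hF₂ hgeom

end Clustering

/-! ### §2 The connected three-point function: cumulant algebra -/

section Cumulant

variable {Ω : Type*} [MeasurableSpace Ω] {μ : Measure Ω} [IsProbabilityMeasure μ] {X Y Z : Ω → ℝ} {A B C : ℝ}

/-- The mean of an observable bounded by `A` is bounded by `A`. [folklore] -/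
theorem abs_integral_le_of_abs_le (hA : ∀ ω, |X ω| ≤ A) : |∫ ω, X ω ∂μ| ≤ A := by
  have h := norm_integral_le_of_norm_le_const (μ := μ) (f := X) (C := A)
    (ae_of_all _ fun ω => by simpa [Real.norm_eq_abs] using hA ω)
  simpa [Real.norm_eq_abs] using h

/-- **The connected three-point function in moments**: for bounded measurable `X, Y, Z` under a probability
measure, `Cov(XY, Z) − E[X] Cov(Y, Z) − E[Y] Cov(X, Z) = E[XYZ] − E[XY]E[Z] − E[XZ]E[Y] − E[YZ]E[X] + 2E[X]E[Y]E[Z]`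
— the third cumulant (Ursell function) `u₃(X; Y; Z)`. [folklore] -/
theorem threePoint_eq_moments (hX : Measurable X) (hY : Measurable Y) (hZ : Measurable Z)
    (hA : ∀ ω, |X ω| ≤ A) (hB : ∀ ω, |Y ω| ≤ B) (hC : ∀ ω, |Z ω| ≤ C) :
    cov[fun ω => X ω * Y ω, Z; μ] - (∫ ω, X ω ∂μ) * cov[Y, Z; μ] - (∫ ω, Y ω ∂μ) * cov[X, Z; μ] =
      (∫ ω, X ω * Y ω * Z ω ∂μ) - (∫ ω, X ω * Y ω ∂μ) * (∫ ω, Z ω ∂μ)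
        - (∫ ω, X ω * Z ω ∂μ) * (∫ ω, Y ω ∂μ) - (∫ ω, Y ω * Z ω ∂μ) * (∫ ω, X ω ∂μ)
        + 2 * (∫ ω, X ω ∂μ) * (∫ ω, Y ω ∂μ) * (∫ ω, Z ω ∂μ) := by
  have hAB : ∀ ω, |X ω * Y ω| ≤ A * B := fun ω => by
    rw [abs_mul]; exact mul_le_mul (hA ω) (hB ω) (abs_nonneg _) ((abs_nonneg _).trans (hA ω))
  rw [covariance_eq_sub_of_abs_le (X := fun ω => X ω * Y ω) (hX.mul hY) hZ hAB hC,
    covariance_eq_sub_of_abs_le hY hZ hB hC, covariance_eq_sub_of_abs_le hX hZ hA hC]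
  ring

/-- **Symmetry in the last two slots**: `u₃(X; Y; Z) = u₃(X; Z; Y)`. [folklore] -/
theorem threePoint_swap (hX : Measurable X) (hY : Measurable Y) (hZ : Measurable Z)
    (hA : ∀ ω, |X ω| ≤ A) (hB : ∀ ω, |Y ω| ≤ B) (hC : ∀ ω, |Z ω| ≤ C) :
    cov[fun ω => X ω * Y ω, Z; μ] - (∫ ω, X ω ∂μ) * cov[Y, Z; μ] - (∫ ω, Y ω ∂μ) * cov[X, Z; μ] =
      cov[fun ω => X ω * Z ω, Y; μ] - (∫ ω, X ω ∂μ) * cov[Z, Y; μ] - (∫ ω, Z ω ∂μ) * cov[X, Y; μ] := by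
  rw [threePoint_eq_moments hX hY hZ hA hB hC, threePoint_eq_moments hX hZ hY hA hC hB]
  have e1 : (fun ω => X ω * Z ω * Y ω) = fun ω => X ω * Y ω * Z ω := by funext ω; ring
  have e2 : (fun ω => Z ω * Y ω) = fun ω => Y ω * Z ω := by funext ω; ring
  rw [e1, e2]
  ring

/-- **Rotation**: `u₃(X; Y; Z) = u₃(Y; Z; X)` (so any slot can be isolated). [folklore] -/
theorem threePoint_rotate (hX : Measurable X) (hY : Measurable Y) (hZ : Measurable Z)
    (hA : ∀ ω, |X ω| ≤ A) (hB : ∀ ω, |Y ω| ≤ B) (hC : ∀ ω, |Z ω| ≤ C) :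
    cov[fun ω => X ω * Y ω, Z; μ] - (∫ ω, X ω ∂μ) * cov[Y, Z; μ] - (∫ ω, Y ω ∂μ) * cov[X, Z; μ] =
      cov[fun ω => Y ω * Z ω, X; μ] - (∫ ω, Y ω ∂μ) * cov[Z, X; μ] - (∫ ω, Z ω ∂μ) * cov[Y, X; μ] := by
  rw [threePoint_eq_moments hX hY hZ hA hB hC, threePoint_eq_moments hY hZ hX hB hC hA]
  have e1 : (fun ω => Y ω * Z ω * X ω) = fun ω => X ω * Y ω * Z ω := by funext ω; ring
  have e2 : (fun ω => Y ω * X ω) = fun ω => X ω * Y ω := by funext ω; ring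
  have e3 : (fun ω => Z ω * X ω) = fun ω => X ω * Z ω := by funext ω; ring
  rw [e1, e2, e3]
  ring

/-- **One split of the cumulant**: `|u₃(X; Y; Z)| ≤ |Cov(XY, Z)| + A |Cov(Y, Z)| + B |Cov(X, Z)|` when `|X| ≤ A`,
`|Y| ≤ B` (the slot `Z` is isolated). [folklore] -/
theorem abs_threePoint_le (hA : ∀ ω, |X ω| ≤ A) (hB : ∀ ω, |Y ω| ≤ B) :
    |cov[fun ω => X ω * Y ω, Z; μ] - (∫ ω, X ω ∂μ) * cov[Y, Z; μ] - (∫ ω, Y ω ∂μ) * cov[X, Z; μ]| ≤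
      |cov[fun ω => X ω * Y ω, Z; μ]| + A * |cov[Y, Z; μ]| + B * |cov[X, Z; μ]| := by
  have h1 := abs_integral_le_of_abs_le (μ := μ) hA
  have h2 := abs_integral_le_of_abs_le (μ := μ) hB
  calc |cov[fun ω => X ω * Y ω, Z; μ] - (∫ ω, X ω ∂μ) * cov[Y, Z; μ] - (∫ ω, Y ω ∂μ) * cov[X, Z; μ]|
      ≤ |cov[fun ω => X ω * Y ω, Z; μ] - (∫ ω, X ω ∂μ) * cov[Y, Z; μ]| + |(∫ ω, Y ω ∂μ) * cov[X, Z; μ]| :=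
        abs_sub _ _
    _ ≤ |cov[fun ω => X ω * Y ω, Z; μ]| + |(∫ ω, X ω ∂μ) * cov[Y, Z; μ]| + |(∫ ω, Y ω ∂μ) * cov[X, Z; μ]| := by
        gcongr; exact abs_sub _ _
    _ ≤ |cov[fun ω => X ω * Y ω, Z; μ]| + A * |cov[Y, Z; μ]| + B * |cov[X, Z; μ]| := by
        rw [abs_mul, abs_mul]
        gcongr

end Cumulant

/-! ### §3 Geometry: separations from base points, and the three-split inequality -/

section Geometry

/-- Base points near `x` and near `y` are at least `‖x − y‖ − D₁ − D₂` apart. [folklore] -/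
theorem norm_sub_sub_le_norm_sub {E : Type*} [SeminormedAddCommGroup E] {x y a b : E} {D₁ D₂ : ℝ}
    (ha : ‖a - x‖ ≤ D₁) (hb : ‖b - y‖ ≤ D₂) : ‖x - y‖ - D₁ - D₂ ≤ ‖a - b‖ := by
  have h : ‖x - y‖ ≤ ‖a - x‖ + ‖a - b‖ + ‖b - y‖ := by
    calc ‖x - y‖ = ‖-(a - x) + (a - b) + (b - y)‖ := by congr 1; abel
      _ ≤ ‖-(a - x) + (a - b)‖ + ‖b - y‖ := norm_add_le _ _
      _ ≤ ‖-(a - x)‖ + ‖a - b‖ + ‖b - y‖ := by gcongr; exact norm_add_le _ _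
      _ = ‖a - x‖ + ‖a - b‖ + ‖b - y‖ := by rw [norm_neg]
  linarith

/-- **The three-split inequality**: for `a, b, c ≥ 0` with `a ≤ b + c` (the distances of `x_q` from the centre,
of `x_r` from the centre, and between `x_q` and `x_r`), the best of the three Dobrushin–Shlosman splits decays at
least like `(a + min b c)/4`: `(a + min b c)/4 ≤ max (min b c) (max (min a c) (min a b))`. [folklore] -/
theorem quarter_le_max_three_splits {a b c : ℝ} (ha : 0 ≤ a) (hb : 0 ≤ b) (hc : 0 ≤ c) (htri : a ≤ b + c) :
    (a + min b c) / 4 ≤ max (min b c) (max (min a c) (min a b)) := by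
  set M := max (min b c) (max (min a c) (min a b)) with hM
  have h1 : min b c ≤ M := le_max_left _ _
  have h2 : min a c ≤ M := (le_max_left _ _).trans (le_max_right _ _)
  have h3 : min a b ≤ M := (le_max_right _ _).trans (le_max_right _ _)
  have hbc0 : 0 ≤ min b c := le_min hb hc
  rcases le_total a b with hab | hab
  · rw [min_eq_left hab] at h3
    linarith
  · rw [min_eq_right hab] at h3
    have h4 : a - b ≤ M := by
      rcases le_total a c with hac | hac
      · rw [min_eq_left hac] at h2; linarith
      · rw [min_eq_right hac] at h2; linarith
    linarith

/-- `e^{−t·min b c} ≤ e^{−t b} + e^{−t c}`. [folklore] -/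
theorem exp_neg_mul_min_le {t b c : ℝ} :
    Real.exp (-(t * min b c)) ≤ Real.exp (-(t * b)) + Real.exp (-(t * c)) := by
  rcases min_choice b c with h | h <;> rw [h]
  · exact le_add_of_nonneg_right (Real.exp_pos _).le
  · exact le_add_of_nonneg_left (Real.exp_pos _).le

/-- `e^{−κ((n − (D+2)) − 2)} ≤ e^{κ(D+4)} e^{−κ n}` (truncated subtractions in `ℕ`). [folklore] -/
theorem exp_trunc_sub_le {κ : ℝ} (hκ : 0 ≤ κ) (n D : ℕ) :
    Real.exp (-(κ * (((n - (D + 2) : ℕ) - 2 : ℕ) : ℝ))) ≤ Real.exp (κ * (D + 4)) * Real.exp (-(κ * n)) := by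
  rw [← Real.exp_add]
  refine Real.exp_le_exp.2 ?_
  have h : (n : ℝ) ≤ (((n - (D + 2) : ℕ) - 2 : ℕ) : ℝ) + D + 4 := by
    exact_mod_cast (show n ≤ (n - (D + 2) - 2) + D + 4 by omega)
  nlinarith

/-- **Three splits ⇒ tree bound** (pure real bookkeeping): if a quantity `T` is bounded by
`C e^{−κ((min · · − (D+2)) − 2)}` for the three pairs `(b,c)`, `(a,c)`, `(a,b)` of base-point distances with
`a ≤ b + c`, then `T ≤ C e^{κ(D+4)} e^{−(κ/4)a} (e^{−(κ/4)b} + e^{−(κ/4)c})`. [folklore] -/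
theorem tree_bound_of_three_splits {T C κ : ℝ} {a b c D : ℕ} (hC : 0 ≤ C) (hκ : 0 ≤ κ)
    (htri : (a : ℝ) ≤ b + c)
    (hA : T ≤ C * Real.exp (-(κ * (((min b c - (D + 2) : ℕ) - 2 : ℕ) : ℝ))))
    (hB : T ≤ C * Real.exp (-(κ * (((min a c - (D + 2) : ℕ) - 2 : ℕ) : ℝ))))
    (hC' : T ≤ C * Real.exp (-(κ * (((min a b - (D + 2) : ℕ) - 2 : ℕ) : ℝ)))) :
    T ≤ C * Real.exp (κ * (D + 4)) * Real.exp (-(κ / 4 * a)) *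
      (Real.exp (-(κ / 4 * b)) + Real.exp (-(κ / 4 * c))) := by
  have step : ∀ {u v : ℕ}, T ≤ C * Real.exp (-(κ * (((min u v - (D + 2) : ℕ) - 2 : ℕ) : ℝ))) →
      T ≤ C * Real.exp (κ * (D + 4)) * Real.exp (-(κ * min (u : ℝ) (v : ℝ))) := by
    intro u v h
    have hmin : ((min u v : ℕ) : ℝ) = min (u : ℝ) (v : ℝ) := by push_cast; rfl
    calc T ≤ _ := h
      _ ≤ C * (Real.exp (κ * (D + 4)) * Real.exp (-(κ * ((min u v : ℕ) : ℝ)))) :=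
          mul_le_mul_of_nonneg_left (exp_trunc_sub_le hκ _ _) hC
      _ = _ := by rw [hmin]; ring
  have TA := step hA
  have TB := step hB
  have TC := step hC'
  set Mx : ℝ := max (min (b : ℝ) c) (max (min (a : ℝ) c) (min (a : ℝ) b)) with hMx
  have hquart := quarter_le_max_three_splits (Nat.cast_nonneg a) (Nat.cast_nonneg b) (Nat.cast_nonneg c) htri
  have TM : T ≤ C * Real.exp (κ * (D + 4)) * Real.exp (-(κ * Mx)) := by
    rcases max_choice (min (b : ℝ) c) (max (min (a : ℝ) c) (min (a : ℝ) b)) with h | h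
    · rw [hMx, h]; exact TA
    · rcases max_choice (min (a : ℝ) c) (min (a : ℝ) b) with h' | h'
      · rw [hMx, h, h']; exact TB
      · rw [hMx, h, h']; exact TC
  have hpre : 0 ≤ C * Real.exp (κ * (D + 4)) := by positivity
  calc T ≤ C * Real.exp (κ * (D + 4)) * Real.exp (-(κ * Mx)) := TM
    _ ≤ C * Real.exp (κ * (D + 4)) * Real.exp (-(κ / 4 * ((a : ℝ) + min (b : ℝ) c))) := by
        refine mul_le_mul_of_nonneg_left (Real.exp_le_exp.2 ?_) hpre
        nlinarith
    _ = C * Real.exp (κ * (D + 4)) * Real.exp (-(κ / 4 * (a : ℝ))) * Real.exp (-(κ / 4 * min (b : ℝ) c)) := by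
        rw [mul_assoc (C * Real.exp (κ * (D + 4))), ← Real.exp_add]; congr 1; ring
    _ ≤ _ := mul_le_mul_of_nonneg_left exp_neg_mul_min_le (by positivity)

/-- Bookkeeping of the Lipschitz constants of the splits with a plaquette isolated (`cq, cr ≤ 4` links,
`c32 = 4·2³`, `c1 = 1`). [folklore] -/
theorem bracket_plaquette_le {L Kr Mr cq cr c32 c1 : ℝ} (h32 : c32 = 32) (h1 : c1 = 1) (hL : 0 ≤ L)
    (hK : 0 ≤ Kr) (hM : 0 ≤ Mr) (hcq0 : 0 ≤ cq) (hcq : cq ≤ 4) (hcr0 : 0 ≤ cr) (hcr : cr ≤ 4) :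
    ((L + cq) * (Mr * c32 + c1 * Kr) + Mr * (cq * c32) + c1 * (L * Kr)) * (cr * c32) ≤
      128 * ((L + 4) * (32 * Mr + Kr)) + 16384 * Mr + 1024 * (L * Kr) := by
  subst h32 h1
  have hin0 : 0 ≤ (L + cq) * (Mr * 32 + 1 * Kr) + Mr * (cq * 32) + 1 * (L * Kr) := by positivity
  have hin : (L + cq) * (Mr * 32 + 1 * Kr) + Mr * (cq * 32) + 1 * (L * Kr) ≤
      (L + 4) * (Mr * 32 + 1 * Kr) + Mr * (4 * 32) + 1 * (L * Kr) := by
    have h1' : (L + cq) * (Mr * 32 + 1 * Kr) ≤ (L + 4) * (Mr * 32 + 1 * Kr) :=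
      mul_le_mul_of_nonneg_right (by linarith) (by positivity)
    have h2' : Mr * (cq * 32) ≤ Mr * (4 * 32) := mul_le_mul_of_nonneg_left (by linarith) hM
    linarith
  calc _ ≤ ((L + 4) * (Mr * 32 + 1 * Kr) + Mr * (4 * 32) + 1 * (L * Kr)) * (4 * 32) :=
        mul_le_mul hin (by linarith) (by positivity) (hin0.trans hin)
    _ ≤ _ := by nlinarith [mul_nonneg hL hK]

/-- Bookkeeping of the Lipschitz constants of the split with `F` isolated. [folklore] -/
theorem bracket_cylinder_le {L Kr Mr cq cr c32 c1 : ℝ} (h32 : c32 = 32) (h1 : c1 = 1) (hL : 0 ≤ L)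
    (hK : 0 ≤ Kr) (hM : 0 ≤ Mr) (hcq : cq ≤ 4) (hcr : cr ≤ 4) :
    ((cq + cr) * (c1 * c32 + c1 * c32) + c1 * (cr * c32) + c1 * (cq * c32)) * (L * Kr) ≤
      128 * ((L + 4) * (32 * Mr + Kr)) + 16384 * Mr + 1024 * (L * Kr) := by
  subst h32 h1
  have hLK : 0 ≤ L * Kr := mul_nonneg hL hK
  have hin : (cq + cr) * (1 * 32 + 1 * 32) + 1 * (cr * 32) + 1 * (cq * 32) ≤ 768 := by linarith
  calc _ ≤ 768 * (L * Kr) := mul_le_mul_of_nonneg_right hin hLK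
    _ ≤ _ := by nlinarith [mul_nonneg hL hM]

/-- Supports near two centres are separated by the distance of the centres minus the radii (natural-number
form for the clustering hypotheses). [folklore] -/
theorem sep_of_near {S₁ S₂ : Finset (ZdEdge 4)} {y₁ y₂ : Literature.Probability.LatticeModels.Site 4}
    {D₁ D₂ : ℕ} (h₁ : ∀ e ∈ S₁, ‖e.1 - y₁‖ ≤ D₁) (h₂ : ∀ e ∈ S₂, ‖e.1 - y₂‖ ≤ D₂) {m : ℕ}
    (hm : m ≤ Literature.Probability.LatticeModels.Site.supNorm (y₁ - y₂) - (D₁ + D₂)) :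
    ∀ a ∈ S₁, ∀ b ∈ S₂, (m : ℝ) ≤ ‖a.1 - b.1‖ := by
  intro a ha b hb
  have h := norm_sub_sub_le_norm_sub (h₁ a ha) (h₂ b hb)
  rw [Literature.Probability.LatticeModels.Site.norm_eq_supNorm] at h
  rcases le_or_gt (D₁ + D₂) (Literature.Probability.LatticeModels.Site.supNorm (y₁ - y₂)) with hle | hlt
  · have hm' : (m : ℝ) ≤ (Literature.Probability.LatticeModels.Site.supNorm (y₁ - y₂) : ℝ) - (D₁ + D₂) := by
      have := (Nat.cast_le (α := ℝ)).2 hm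
      rw [Nat.cast_sub hle] at this
      push_cast at this
      exact this
    linarith
  · have hm0 : m = 0 := by omega
    rw [hm0, Nat.cast_zero]
    exact norm_nonneg _

end Geometry

end Summit.Ventures.YMGap.CouplingResponse

end
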